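import Summits.QuantumFields.BalabanUV.T4Continuum.Spine.NE7cSmoothingLocal

/-!
# T⁴ programme, spine node NE7c (U5b) — ROAD P3 «SMOOTHING»: a SEPARATION WITNESS for the localised remainder sandwich — the
# localised binder `hswL` of `NE7cSmoothingLocal.core_sandwich_local` holds (radius `0`) where the global binder `hsw` of
# `T4LipschitzLedger.core_sandwich` is FALSE

Cell `pub-balaban`, BINDER-OWNERS row NE7c, co-owner #3 = unit `b2b-balaban-t4-ne7c-p3` (GEN 2), skeleton
`HOME/t4/skeletons/NE7c-t4-ne7c-p3.md` §4 («WHERE R IS LOAD-BEARING») / §5 checklist; companion of `Spine/NE7cSmoothingLocal`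
(p208168) — GAPS G-ne7cp3-g2-3.

THE TOY (no print, no Bałaban object; the index/profile/slot data `T`, `χ`, `κ`, `Lχ`, `n`, `m`, `slot`, `pol`, `θ`, `profiles` are REUSED
from `T4LipschitzLedger.Sanity` BY NAME; new here: a TWO-POINT window space): one term per cutoff; window
space `Bool` with the counting measure; ONE small-field letter with profile `linProfile (1/2)` and threshold `1`; the tested variable is
THE SAME in both runs (`0` at `true` — deep small field, letter `= 1`; `2` at `false` — large field, letter `= 0`); run A's remainder is
`1`; run B's remainder is `1` at `true` and `100` at `false` — the two runs' old densities agree on the common small-field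
configuration and differ WILDLY off it.  THEN: both runs are represented (`termRepr_A`, `termRepr_B`; weights `A = B = 1`), the
LOCALISED sandwich holds with constant `0` and radius `0` (`local_sandwich`), the GLOBAL upper sandwich FAILS for every radius
`< log 100` (`not_global_sandwich`: already `RB ≤ e·RA` is false at `false`), and `core_sandwich_local` FIRES (`cores_sandwiched`):
the core pieces are sandwiched with radius `vol·0 = 0`.  So the weakening `hsw ↦ hswL` of p208168 is STRICT, and it is the declared
letter that carries it (remove the letter and the two weights are `2` vs `101`).  [folklore]; 0 sorry; NOT summit progress;
spine 0/9.  HONEST DEPENDENCY: continuum YM on T⁴ ⇐ BetaPertH ∧ nine spine estimates (0/9 proved); BetaPertH ⇐ (D1) ∧ (D4) ∧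
CAP+tail; G-an2-4 gates asym, D1 and NE2/3/4.
-/

noncomputable section

open MeasureTheory Finset Filter
open scoped NNReal ENNReal

namespace Summit.QuantumFields.BalabanUV.T4Continuum.NE7cSmoothingLocal.Toy

open Literature.MathematicalPhysics.QuantumFieldTheory.Balaban1983to89
open T4IndicatorShell T4LipschitzCutoff T4LipschitzLedger
open Summit.QuantumFields.BalabanUV.T4Continuum.NE7cSmoothingLocal

/-- the window space: two configurations (`true` = deep small field, `false` = large field). [folklore] -/
abbrev Ω : ℕ → Unit → Type := fun _ _ => Bool

/-- the counting measure. [folklore] -/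
def μ : (K : ℕ) → (τ : Unit) → Measure (Ω K τ) := fun _ _ => Measure.count

/-- THE tested variable (identical in the two runs): `0` at `true`, `2` at `false`. [folklore] -/
def u : (K : ℕ) → (τ : Unit) → ℕ → Ω K τ → ℝ := fun _ _ _ v => if v then 0 else 2

/-- run A's remainder: `1`. [folklore] -/
def RA : (K : ℕ) → ℝ → (τ : Unit) → Ω K τ → ℝ := fun _ _ _ _ => 1

/-- run B's remainder: `1` on the small-field configuration, `100` off it. [folklore] -/
def RB : (K : ℕ) → ℝ → (τ : Unit) → Ω K τ → ℝ := fun _ _ _ v => if v then 1 else 100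

/-- both runs' term weights: `1`. [folklore] -/
def A : ℕ → ℝ → Unit → ℝ := fun _ _ _ => 1

/-- the letter: `1` at `true`, `0` at `false`. [folklore] -/
theorem facAt_eq (K : ℕ) (v : Bool) :
    facAt Sanity.χ (Sanity.slot K ()) (Sanity.pol K ()) (Sanity.θ K ()) (fun j => u K () j v) 0 = if v then 1 else 0 := by
  simp only [facAt, Sanity.pol, Sanity.χ, Sanity.θ, u, Pol.fac_small]
  cases v
  · simp only [if_false, Bool.false_eq_true]
    exact (linProfile_lipProfile (by norm_num) (by norm_num)).eq_zero _ (by norm_num)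
  · simp only [if_true]
    exact (linProfile_lipProfile (by norm_num) (by norm_num)).eq_one _ (by norm_num)

/-- run A is represented (`A = 1·1 + 0·1`). [folklore] -/
theorem termRepr_A : TermRepr 1 Sanity.T A Sanity.χ Sanity.κ Sanity.Lχ 0 Sanity.n μ Sanity.m Sanity.slot Sanity.pol Sanity.θ u u RA where
  profile := Sanity.profiles
  thr_pos K τ _ i _ := by simp [Sanity.θ]
  slot_mem K τ _ i _ := by simp [Sanity.slot, Sanity.n, Finset.mem_sigma]
  slot_band K τ _ i _ := by simp [Sanity.slot]
  meas K τ _ i _ := ⟨.of_discrete, .of_discrete⟩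
  rem_nonneg K t _ τ _ := ae_of_all _ fun v => by simp [RA]
  rem_int K t _ τ _ := by simp only [μ]; exact .of_finite
  repr K t _ τ _ := by
    obtain ⟨⟩ := τ
    simp only [μ, integral_count, Sanity.m, prod_range_one, RA, mul_one, facAt_eq, Fintype.sum_bool, A]
    norm_num

/-- run B is represented (`B = 1·1 + 0·100`). [folklore] -/
theorem termRepr_B : TermRepr 1 Sanity.T A Sanity.χ Sanity.κ Sanity.Lχ 0 Sanity.n μ Sanity.m Sanity.slot Sanity.pol Sanity.θ u u RB where
  profile := Sanity.profiles
  thr_pos K τ _ i _ := by simp [Sanity.θ]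
  slot_mem K τ _ i _ := by simp [Sanity.slot, Sanity.n, Finset.mem_sigma]
  slot_band K τ _ i _ := by simp [Sanity.slot]
  meas K τ _ i _ := ⟨.of_discrete, .of_discrete⟩
  rem_nonneg K t _ τ _ := ae_of_all _ fun v => by simp only [RB]; split_ifs <;> norm_num
  rem_int K t _ τ _ := by simp only [μ]; exact .of_finite
  repr K t _ τ _ := by
    obtain ⟨⟩ := τ
    simp only [μ, integral_count, Sanity.m, prod_range_one, RB, facAt_eq, Fintype.sum_bool, A]
    norm_num

/-- **THE LOCALISED SANDWICH HOLDS with constant `0` and radius `vol·0`** (no bad class): on the joint polarity event the letter is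
«on», i.e. the configuration is `true`, where both remainders are `1`. [folklore] -/
theorem local_sandwich (vol : ℝ) : ∀ K t, |t| ≤ (1 : ℝ) → ∀ τ ∈ Sanity.T K \ (fun _ _ => (∅ : Finset Unit)) K t,
    (∀ᵐ v ∂(μ K τ), (∀ i < Sanity.m K τ, facAt Sanity.χ (Sanity.slot K τ) (Sanity.pol K τ) (Sanity.θ K τ) (fun j => u K τ j v) i ≠ 0 ∧
        facAt Sanity.χ (Sanity.slot K τ) (Sanity.pol K τ) (Sanity.θ K τ) (fun j => u K τ j v) i ≠ 0) →
      Real.exp ((fun _ => (0 : ℝ)) K - vol * (fun _ => (0 : ℝ)) K) * RA K t τ v ≤ RB K t τ v) ∧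
    (∀ᵐ v ∂(μ K τ), (∀ i < Sanity.m K τ, facAt Sanity.χ (Sanity.slot K τ) (Sanity.pol K τ) (Sanity.θ K τ) (fun j => u K τ j v) i ≠ 0 ∧
        facAt Sanity.χ (Sanity.slot K τ) (Sanity.pol K τ) (Sanity.θ K τ) (fun j => u K τ j v) i ≠ 0) →
      RB K t τ v ≤ Real.exp ((fun _ => (0 : ℝ)) K + vol * (fun _ => (0 : ℝ)) K) * RA K t τ v) := by
  intro K t _ τ _
  obtain ⟨⟩ := τ
  have key : ∀ v : Bool, (∀ i < Sanity.m K (), facAt Sanity.χ (Sanity.slot K ()) (Sanity.pol K ()) (Sanity.θ K ()) (fun j => u K () j v) i ≠ 0 ∧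
      facAt Sanity.χ (Sanity.slot K ()) (Sanity.pol K ()) (Sanity.θ K ()) (fun j => u K () j v) i ≠ 0) → v = true := by
    intro v hv
    have h0 := (hv 0 (by simp [Sanity.m])).1
    rw [facAt_eq] at h0
    cases v
    · simp at h0
    · rfl
  constructor <;>
  · refine ae_of_all _ fun v hv => ?_
    rw [key v hv]
    simp [RA, RB]

/-- **THE GLOBAL SANDWICH IS FALSE**: already `RB ≤ e¹·RA` fails at the large-field configuration (`100 ≤ e` is false), so NO
radius `vol·δ_K ≤ 1` can serve `T4LipschitzLedger.core_sandwich`'s global `hsw` here — while `local_sandwich` has radius `0`.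
[folklore] -/
theorem not_global_sandwich (K : ℕ) (t : ℝ) :
    ¬ (∀ᵐ v ∂(μ K ()), RB K t () v ≤ Real.exp (0 + 1) * RA K t () v) := by
  simp only [μ, Measure.ae_count_iff, not_forall]
  refine ⟨false, ?_⟩
  simp only [RB, RA, Bool.false_eq_true, if_false, mul_one, zero_add, not_le]
  have := Real.exp_one_lt_d9
  linarith

/-- **`core_sandwich_local` FIRES**: the core pieces of the two runs are sandwiched with radius `vol·0` at every cutoff — from the
LOCALISED binder alone. [folklore] -/
theorem cores_sandwiched (vol : ℝ) : ∀ K : ℕ, ∃ c' : ℝ, ∀ t : ℝ, |t| ≤ 1 → ∀ τ ∈ Sanity.T K \ (fun _ _ => (∅ : Finset Unit)) K t,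
    Real.exp (c' - vol * (fun _ => (0 : ℝ)) K) * (A K t τ - shellW Sanity.χ μ Sanity.m Sanity.slot Sanity.pol Sanity.θ u u RA K t τ) ≤
        A K t τ - shellW Sanity.χ μ Sanity.m Sanity.slot Sanity.pol Sanity.θ u u RB K t τ ∧
      A K t τ - shellW Sanity.χ μ Sanity.m Sanity.slot Sanity.pol Sanity.θ u u RB K t τ ≤
        Real.exp (c' + vol * (fun _ => (0 : ℝ)) K) * (A K t τ - shellW Sanity.χ μ Sanity.m Sanity.slot Sanity.pol Sanity.θ u u RA K t τ) :=
  core_sandwich_local termRepr_A termRepr_B (local_sandwich vol)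

/-- WITHOUT THE LETTER the two weights are `2` and `101`: the declared letter is what makes the two runs comparable here — it is
NOT inert under the localised binder. [folklore] -/
theorem letterless_weights (K : ℕ) (t : ℝ) :
    (∫ v, RA K t () v ∂(μ K ())) = 2 ∧ (∫ v, RB K t () v ∂(μ K ())) = 101 := by
  simp only [μ, integral_count, RA, RB, Fintype.sum_bool]
  norm_num

end Summit.QuantumFields.BalabanUV.T4Continuum.NE7cSmoothingLocal.Toy

end
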